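import Literature.NumberTheory.LFunctions.FordZetaZeroDetector
import Literature.NumberTheory.LFunctions.FordLogZetaIntegralBound
import Literature.NumberTheory.LFunctions.FordZetaBoundCrude
import Literature.NumberTheory.LFunctions.ZetaClassicalRegionBounds
import HarnessLib

/-!
# Ford's zero detector for `ζ` at `σ = 1` for EVERY `η ∈ (0, 1/2]` (removal of the "good `η`" hypothesis)

Topic `Literature/NumberTheory/LFunctions`, family RH (explicit Vinogradov–Korobov zero-free
regions). Everything in this file is PROVED; no definition, no named fact.

The tree's zero detector for `ζ` (`FordZetaDetector.ford_zero_detector_zeta`,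
`FordZetaZeroDetector.lean`; Ford 2002, Lemma 2.2 for `f = ζ`) is stated under Ford's hypothesis
that `η` is "good" — no zero of `ζ` lies on the left line `Re z = σ − η`. Ford (proof of
Lemma 4.1): "if `η` is bad … apply the above argument with a sequence of numbers `η'` tending
to `η`". Mossinghoff–Trudgian–Yang's Lemma 6.1 (and Ford's §9) use `σ = 1`, `η = 1/2`, where the
left line IS the critical line, so this limiting step is essential and cannot be replaced by
inserting the bound (3.1) first. Here we carry it out for the raw detector at `σ = 1`:

* `FordZetaDetector.ford_zero_detector_zeta_one` — for `t ≠ 0`, `0 < η ≤ 1/2` and every finite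
  set `S` of zeros with `Re ρ > 1 − η`,
  `−Re (ζ'/ζ)(1+it) ≤ Σ_{ρ∈S} m(ρ) Re h_η(ρ − 1 − it)`
  `    + (1/4η)[∫ log|ζ(1−η+i(t+2ηu/π))|/cosh²u du − ∫ log|ζ(1+η+i(t+2ηu/π))|/cosh²u du]`.

Proof: good `η'_k ↑ η` exist since the zeros are countable (`countable_riemannZetaZeros`,
`exists_good_eta`); at `σ = 1` the pole term of `ford_zero_detector_zeta` vanishes; the finite
sum and the right integral are continuous in `η'` (dominated convergence, `|log|ζ(x+iy)|| ≤
log(3/η)` for `x − 1 ≥ η/2`); for the LEFT integral only `limsup_k ∫ g_k ≤ ∫ g` is needed and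
holds by Fatou's lemma applied to `G − g_k ≥ 0` with the integrable majorant
`G(u) = (A + |u|)/cosh²u` coming from the crude bounds `log|ζ(x+iy)| ≤ A + log(2+|y|)` on
`1/2 ≤ x ≤ 1 − η/2` (`log_norm_zeta_le_crude`), the pointwise convergence holding off the
countably many `u` at which the limit point is a zero (`eventually_integral_le_of_tendsto`).

## References

* K. Ford, *Zero-free regions for the Riemann zeta function*, Number Theory for the Millennium II
  (Urbana 2000), A K Peters 2002 = arXiv:1910.08205: Lemma 2.2, proof of Lemma 4.1 (last
  sentence), §9. [Ford2002Millennium]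
* M. J. Mossinghoff, T. S. Trudgian, A. Yang, Res. Number Theory 10 (2024) = arXiv:2212.06867:
  Lemma 4.1, (6.2). [MossinghoffTrudgianYangRNT2024]
-/

noncomputable section

open Complex Set Metric Filter Topology MeasureTheory Real
open Literature.Analysis.Complex Literature.Analysis.Complex.FordDetector
open scoped ENNReal ComplexConjugate

namespace Literature.NumberTheory.LFunctions

namespace FordZetaDetector

/-! ### A one-sided dominated-convergence (Fatou) lemma -/

/-- **Upper semicontinuity of the integral under an integrable majorant** (reverse Fatou): if
`g_k ≤ G` a.e. with `G`, `g_k`, `h` integrable and `g_k → h` a.e., then for every `ε > 0`,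
eventually `∫ g_k ≤ ∫ h + ε`. (Fatou's lemma for `G − g_k ≥ 0`.) [folklore] -/
theorem eventually_integral_le_of_tendsto {g : ℕ → ℝ → ℝ} {G h : ℝ → ℝ}
    (hG : Integrable G) (hg : ∀ k, Integrable (g k)) (hh : Integrable h)
    (hle : ∀ k, ∀ᵐ u, g k u ≤ G u) (hlim : ∀ᵐ u, Tendsto (fun k ↦ g k u) atTop (𝓝 (h u)))
    {ε : ℝ} (hε : 0 < ε) : ∀ᶠ k in atTop, ∫ u, g k u ≤ (∫ u, h u) + ε := by
  -- `h ≤ G` a.e.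
  have hhG : ∀ᵐ u, h u ≤ G u := by
    have hall : ∀ᵐ u, ∀ k, g k u ≤ G u := ae_all_iff.2 hle
    filter_upwards [hall, hlim] with u hu hl
    exact le_of_tendsto' hl hu
  -- Fatou for `F_k = ofReal (G - g_k)`
  set F : ℕ → ℝ → ℝ≥0∞ := fun k u ↦ ENNReal.ofReal (G u - g k u) with hF
  have hFm : ∀ k, AEMeasurable (F k) := fun k ↦
    ((hG.sub (hg k)).aemeasurable).ennreal_ofReal
  have hfatou := lintegral_liminf_le' (μ := volume) (u := atTop) hFm
  -- identify the two sides
  have hlhs : ∫⁻ u, liminf (fun k ↦ F k u) atTop = ENNReal.ofReal (∫ u, (G u - h u)) := by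
    have hae : (fun u ↦ liminf (fun k ↦ F k u) atTop) =ᵐ[volume] fun u ↦ ENNReal.ofReal (G u - h u) := by
      filter_upwards [hlim] with u hl
      have ht : Tendsto (fun k ↦ F k u) atTop (𝓝 (ENNReal.ofReal (G u - h u))) :=
        (ENNReal.continuous_ofReal.tendsto _).comp (tendsto_const_nhds.sub hl)
      exact ht.liminf_eq
    rw [lintegral_congr_ae hae]
    exact (ofReal_integral_eq_lintegral_ofReal (hG.sub hh)
      (by filter_upwards [hhG] with u hu; simpa using hu)).symm
  have hrhs : ∀ k, ∫⁻ u, F k u = ENNReal.ofReal (∫ u, (G u - g k u)) := fun k ↦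
    (ofReal_integral_eq_lintegral_ofReal (hG.sub (hg k))
      (by filter_upwards [hle k] with u hu; simpa using hu)).symm
  rw [hlhs] at hfatou
  simp_rw [hrhs] at hfatou
  rw [integral_sub hG hh] at hfatou
  -- trivial case: `∫ h + ε > ∫ G`
  by_cases hcase : (∫ u, G u) < (∫ u, h u) + ε
  · refine Eventually.of_forall fun k ↦ ?_
    have : ∫ u, g k u ≤ ∫ u, G u := integral_mono_ae (hg k) hG (hle k)
    linarith
  push Not at hcase
  -- otherwise `0 ≤ ∫G − ∫h − ε < ∫G − ∫h ≤ liminf`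
  have hb : ENNReal.ofReal ((∫ u, G u) - (∫ u, h u) - ε) <
      ENNReal.ofReal ((∫ u, G u) - ∫ u, h u) := by
    rw [ENNReal.ofReal_lt_ofReal_iff (by linarith)]
    linarith
  have hev := eventually_lt_of_lt_liminf (hb.trans_le hfatou)
  filter_upwards [hev] with k hk
  rw [integral_sub hG (hg k), ENNReal.ofReal_lt_ofReal_iff'] at hk
  linarith [hk.1]

/-! ### The zeros of `ζ` are countable; good abscissae -/

/-- The zero set of `ζ` is countable (finitely many zeros in each disc). [folklore] -/
theorem countable_riemannZetaZeros : riemannZetaZeros.Countable := by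
  have hcover : riemannZetaZeros = ⋃ n : ℕ, (Metric.closedBall (0 : ℂ) n ∩ riemannZetaZeros) := by
    ext ρ
    simp only [mem_iUnion, mem_inter_iff, Metric.mem_closedBall, dist_zero_right]
    constructor
    · intro h
      obtain ⟨n, hn⟩ := exists_nat_ge ‖ρ‖
      exact ⟨n, hn, h⟩
    · rintro ⟨n, -, h⟩
      exact h
  rw [hcover]
  exact countable_iUnion fun n ↦
    ((isCompact_closedBall (0 : ℂ) n).inter_riemannZetaZeros_finite).countable

/-- **Good abscissae are dense**: every interval `(a, b)`, `a < b`, contains an `η'` such that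
no zero of `ζ` has real part `1 − η'` (the real parts of the zeros form a countable, hence null,
set). [cite: Ford2002Millennium, Lemma 2.2 (the exceptional set has measure 0)] -/
theorem exists_good_eta {a b : ℝ} (hab : a < b) :
    ∃ η' ∈ Ioo a b, ∀ ρ : ℂ, riemannZeta ρ = 0 → ρ.re ≠ 1 - η' := by
  set B : Set ℝ := (fun ρ : ℂ ↦ 1 - ρ.re) '' riemannZetaZeros with hB
  have hBc : B.Countable := countable_riemannZetaZeros.image _
  have hB0 : volume B = 0 := hBc.measure_zero volume
  by_contra hcon
  push Not at hcon
  have hsub : Ioo a b ⊆ B := by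
    intro η' hη'
    obtain ⟨ρ, hρ, hre⟩ := hcon η' hη'
    exact ⟨ρ, hρ, by show 1 - ρ.re = η'; rw [hre]; ring⟩
  have h1 : volume (Ioo a b) ≤ volume B := measure_mono hsub
  rw [hB0, Real.volume_Ioo] at h1
  have : ENNReal.ofReal (b - a) = 0 := le_antisymm h1 bot_le
  rw [ENNReal.ofReal_eq_zero] at this
  linarith

/-! ### Crude bounds for `log|ζ|` -/

/-- **`log|ζ(x + iy)| ≤ A_δ + log(2 + |y|)` on `1/2 ≤ x ≤ 1 − δ`** (`0 < δ ≤ 1/2`), all real `y`,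
with `A_δ = log(1/δ + 4) + log 6 + log 3`: near the pole `log|ζ| ≤ log(1/(1−x) + 4)`
(`FordL34.log_norm_zeta_le_near_of_lt_one`), `|ζ| ≤ 6` for `1 ≤ |y| ≤ 3`
(`FordL34.norm_zeta_le_six`), and `|ζ(x+iy)| ≤ 3(|y| + 1)` for `|y| ≥ 3` (order-`0`
Euler–Maclaurin, `FordVK.norm_zeta_le_sum_add`, and conjugation). [folklore] -/
theorem log_norm_zeta_le_crude {δ : ℝ} (hδ : 0 < δ) (hδ2 : δ ≤ 1 / 2) {x : ℝ} (hx : 1 / 2 ≤ x)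
    (hx1 : x ≤ 1 - δ) (y : ℝ) :
    Real.log ‖riemannZeta (x + y * I)‖ ≤
      (Real.log (1 / δ + 4) + Real.log 6 + Real.log 3) + Real.log (2 + |y|) := by
  have hA1 : 0 ≤ Real.log (1 / δ + 4) := Real.log_nonneg (by
    have : 0 < 1 / δ := by positivity
    linarith)
  have hA2 : 0 ≤ Real.log 6 := Real.log_nonneg (by norm_num)
  have hA3 : 0 ≤ Real.log 3 := Real.log_nonneg (by norm_num)
  have hL : 0 ≤ Real.log (2 + |y|) := Real.log_nonneg (by linarith [abs_nonneg y])
  have hx' : x < 1 := by linarith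
  -- the bound for `y ≥ 3` (and `1/2 ≤ x ≤ 1`)
  have hlarge : ∀ {x' y' : ℝ}, 1 / 2 ≤ x' → x' ≤ 1 → 3 ≤ y' →
      Real.log ‖riemannZeta (x' + y' * I)‖ ≤ Real.log 3 + Real.log (2 + |y'|) := by
    intro x' y' hx' hx'1 hy'
    have hb := FordVK.norm_zeta_le_sum_add hy' hx' hx'1
    set N : ℕ := ⌊y'⌋₊ + 1 with hN
    have hN1 : (1 : ℝ) ≤ N := by rw [hN]; push_cast; linarith [(Nat.cast_nonneg ⌊y'⌋₊ : (0 : ℝ) ≤ ⌊y'⌋₊)]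
    have hNy : (N : ℝ) ≤ y' + 1 := by
      rw [hN]; push_cast; linarith [Nat.floor_le (by linarith : (0 : ℝ) ≤ y')]
    have hsum : ∑ n ∈ Finset.Icc 1 N, (n : ℝ) ^ (-x') ≤ N := by
      have hle : ∀ n ∈ Finset.Icc 1 N, (n : ℝ) ^ (-x') ≤ 1 := by
        intro n hn
        rw [Finset.mem_Icc] at hn
        have hn1 : (1 : ℝ) ≤ n := by exact_mod_cast hn.1
        exact Real.rpow_le_one_of_one_le_of_nonpos hn1 (by linarith)
      calc ∑ n ∈ Finset.Icc 1 N, (n : ℝ) ^ (-x') ≤ ∑ n ∈ Finset.Icc 1 N, (1 : ℝ) :=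
            Finset.sum_le_sum hle
        _ = N := by simp
    have hpow : ((N : ℕ) : ℝ) ^ (1 - x') ≤ N := by
      have : ((N : ℕ) : ℝ) ^ (1 - x') ≤ ((N : ℕ) : ℝ) ^ (1 : ℝ) :=
        Real.rpow_le_rpow_of_exponent_le hN1 (by linarith)
      simpa using this
    have hζ : ‖riemannZeta (x' + y' * I)‖ ≤ 3 * (2 + |y'|) := by
      have habs : |y'| = y' := abs_of_nonneg (by linarith)
      calc ‖riemannZeta (x' + y' * I)‖ ≤ N + 11 / 6 * N := by linarith [hb, hsum, hpow]
        _ ≤ 3 * (2 + |y'|) := by rw [habs]; linarith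
    refine (FordL34.log_norm_le_log (by linarith [abs_nonneg y']) hζ).trans ?_
    rw [Real.log_mul (by norm_num) (by linarith [abs_nonneg y'])]
  rcases lt_or_ge |y| 1 with hy1 | hy1
  · -- near the pole
    have h := FordL34.log_norm_zeta_le_near_of_lt_one hx hx' hy1
    have h2 : Real.log (1 / (1 - x) + 4) ≤ Real.log (1 / δ + 4) := by
      refine Real.log_le_log (by have : 0 < 1 / (1 - x) := by positivity
                                 linarith) ?_
      have : 1 / (1 - x) ≤ 1 / δ := one_div_le_one_div_of_le hδ (by linarith)
      linarith
    linarith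
  rcases le_or_gt |y| 3 with hy3 | hy3
  · -- `1 ≤ |y| ≤ 3`
    have h := norm_zeta_le_six hx hx'.le hy1 hy3
    have := FordL34.log_norm_le_log (by norm_num) h
    linarith
  · -- `|y| > 3`
    rcases le_or_gt 0 y with hy0 | hy0
    · have habs : |y| = y := abs_of_nonneg hy0
      have hy3' : 3 ≤ y := by rw [habs] at hy3; exact hy3.le
      have h := hlarge hx hx'.le hy3'
      linarith
    · -- `y < -3`: conjugate
      have habs : |y| = -y := abs_of_neg hy0
      have hconj : ‖riemannZeta (x + y * I)‖ = ‖riemannZeta (x + (-y : ℝ) * I)‖ := by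
        have e : (x : ℂ) + ((-y : ℝ) : ℂ) * I = conj ((x : ℂ) + y * I) := by
          apply Complex.ext <;> simp
        rw [e, riemannZeta_conj, Complex.norm_conj]
      rw [hconj]
      have hy3' : 3 ≤ -y := by rw [habs] at hy3; exact hy3.le
      have h := hlarge hx hx'.le hy3'
      rw [abs_neg] at h
      linarith

/-- **`|log|ζ(x + iy)|| ≤ log(3/η)` for `1 + η/2 ≤ x ≤ 3/2`** (`0 < η ≤ 1/2`): `|ζ| ≤ x/(x−1) ≤ 3/η`
and `|1/ζ| ≤ x/(x−1)`. [cite: Ford2002Millennium, Lemma 3.1] -/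
theorem abs_log_norm_zeta_le_right {η : ℝ} (hη : 0 < η) (hη2 : η ≤ 1 / 2) {x : ℝ}
    (hx : 1 + η / 2 ≤ x) (hx2 : x ≤ 3 / 2) (y : ℝ) :
    |Real.log ‖riemannZeta (x + y * I)‖| ≤ Real.log (3 / η) := by
  set s : ℂ := (x : ℂ) + y * I with hs
  have hsre : s.re = x := by simp [hs]
  have hx1 : 1 < s.re := by rw [hsre]; linarith
  have hb1 := ZetaClassicalRegion.norm_riemannZeta_le_of_one_lt_re hx1
  have hb2 := ZetaClassicalRegion.norm_inv_riemannZeta_le_of_one_lt_re hx1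
  rw [hsre] at hb1 hb2
  have hq : x / (x - 1) ≤ 3 / η := by
    rw [div_le_div_iff₀ (by linarith) hη]
    nlinarith
  have h3η : 1 ≤ 3 / η := by rw [le_div_iff₀ hη]; linarith
  have hζ0 : riemannZeta s ≠ 0 := riemannZeta_ne_zero_of_one_lt_re hx1
  have hpos : 0 < ‖riemannZeta s‖ := norm_pos_iff.2 hζ0
  rw [abs_le]
  constructor
  · -- lower bound from `‖ζ⁻¹‖ ≤ 3/η`
    rw [norm_inv] at hb2
    have h1 : ‖riemannZeta s‖⁻¹ ≤ 3 / η := hb2.trans hq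
    have h2 : Real.log ‖riemannZeta s‖⁻¹ ≤ Real.log (3 / η) :=
      Real.log_le_log (inv_pos.2 hpos) h1
    rw [Real.log_inv] at h2
    linarith
  · exact Real.log_le_log hpos (hb1.trans hq)

/-! ### The main theorem -/

/-- **Ford's zero detector for `ζ` at `σ = 1`, for every `η ∈ (0, 1/2]`** (no "good `η`"
hypothesis): for `t ≠ 0` and any finite set `S` of zeros of `ζ` with `Re ρ > 1 − η`,
`−Re (ζ'/ζ)(1 + it) ≤ Σ_{ρ∈S} m(ρ) Re h_η(ρ − 1 − it)`
`  + (1/4η)[∫ log|ζ(1−η+i(t+2ηu/π))|/cosh²u du − ∫ log|ζ(1+η+i(t+2ηu/π))|/cosh²u du]`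
(`h_η(z) = (π/2η)cot(πz/2η)`; `m = riemannZetaZeroOrder`). Ford, proof of Lemma 4.1: "if `η`
is bad … apply the argument with a sequence `η' → η`"; here `η' ↑ η` through good values, with
dominated convergence on the right line and Fatou's lemma on the left line.
[cite: Ford2002Millennium, Lemma 2.2 and proof of Lemma 4.1]
[cite: MossinghoffTrudgianYangRNT2024, Lemma 4.1] -/
theorem ford_zero_detector_zeta_one {t η : ℝ} (hη : 0 < η) (hη2 : η ≤ 1 / 2) (ht : t ≠ 0)
    (S : Finset ℂ) (hS : ∀ ρ ∈ S, riemannZeta ρ = 0 ∧ 1 - η < ρ.re) :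
    -(deriv riemannZeta ((1 : ℝ) + t * I) / riemannZeta ((1 : ℝ) + t * I)).re ≤
      (∑ ρ ∈ S, (riemannZetaZeroOrder ρ : ℝ) * (fordCot η (ρ - ((1 : ℝ) + t * I))).re)
      + 1 / (4 * η) *
        ((∫ u : ℝ, Real.log ‖riemannZeta ((1 - η : ℝ) + ((t + u * (2 * η / π) : ℝ) : ℂ) * I)‖ / Real.cosh u ^ 2)
          - ∫ u : ℝ, Real.log ‖riemannZeta ((1 + η : ℝ) + ((t + u * (2 * η / π) : ℝ) : ℂ) * I)‖ / Real.cosh u ^ 2) := by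
  classical
  set s : ℂ := ((1 : ℝ) : ℂ) + t * I with hs
  -- notation for the three `η'`-dependent quantities
  set A : ℝ → ℝ := fun η' ↦ ∑ ρ ∈ S, (riemannZetaZeroOrder ρ : ℝ) * (fordCot η' (ρ - s)).re with hA
  set gL : ℝ → ℝ → ℝ := fun η' u ↦
    Real.log ‖riemannZeta ((1 - η' : ℝ) + ((t + u * (2 * η' / π) : ℝ) : ℂ) * I)‖ / Real.cosh u ^ 2 with hgL
  set gR : ℝ → ℝ → ℝ := fun η' u ↦
    Real.log ‖riemannZeta ((1 + η' : ℝ) + ((t + u * (2 * η' / π) : ℝ) : ℂ) * I)‖ / Real.cosh u ^ 2 with hgR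
  set L : ℝ → ℝ := fun η' ↦ ∫ u, gL η' u with hL
  set R : ℝ → ℝ := fun η' ↦ ∫ u, gR η' u with hR
  change -(deriv riemannZeta s / riemannZeta s).re ≤ A η + 1 / (4 * η) * (L η - R η)
  -- a lower threshold `L₀ < η` beyond which `hS` holds at `η'`
  obtain ⟨L₀, hL₀η, hL₀pos, hL₀S⟩ : ∃ L₀ : ℝ, L₀ < η ∧ η / 2 ≤ L₀ ∧
      ∀ η' : ℝ, L₀ < η' → ∀ ρ ∈ S, 1 - η' < ρ.re := by
    by_cases hSe : S = ∅
    · exact ⟨η / 2, by linarith, le_rfl, fun η' _ ρ hρ ↦ by simp [hSe] at hρ⟩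
    · have hne : S.Nonempty := Finset.nonempty_iff_ne_empty.2 hSe
      set m₀ : ℝ := S.inf' hne fun ρ ↦ ρ.re with hm₀
      have hm₀gt : 1 - η < m₀ := by
        rw [hm₀, Finset.lt_inf'_iff]
        exact fun ρ hρ ↦ (hS ρ hρ).2
      refine ⟨max (η / 2) (1 - m₀), max_lt (by linarith) (by linarith), le_max_left _ _,
        fun η' hη' ρ hρ ↦ ?_⟩
      have h1 : 1 - m₀ < η' := lt_of_le_of_lt (le_max_right _ _) hη'
      have h2 : m₀ ≤ ρ.re := Finset.inf'_le _ hρ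
      linarith
  -- the good sequence `η'_k ∈ (max(η − 1/(k+1), L₀), η)`
  have hlt : ∀ k : ℕ, max (η - 1 / ((k : ℝ) + 1)) L₀ < η := fun k ↦ by
    refine max_lt ?_ hL₀η
    have : (0 : ℝ) < 1 / ((k : ℝ) + 1) := by positivity
    linarith
  have hseq : ∀ k : ℕ, ∃ η' : ℝ, η' ∈ Ioo (max (η - 1 / ((k : ℝ) + 1)) L₀) η ∧
      ∀ ρ : ℂ, riemannZeta ρ = 0 → ρ.re ≠ 1 - η' := fun k ↦ exists_good_eta (hlt k)
  choose η' hη'mem hη'good using hseq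
  have hη'lt : ∀ k, η' k < η := fun k ↦ (hη'mem k).2
  have hη'L₀ : ∀ k, L₀ < η' k := fun k ↦ lt_of_le_of_lt (le_max_right _ _) (hη'mem k).1
  have hη'pos : ∀ k, 0 < η' k := fun k ↦ by linarith [hη'L₀ k]
  have hη'half : ∀ k, η / 2 ≤ η' k := fun k ↦ by linarith [hη'L₀ k]
  have hη'tend : Tendsto η' atTop (𝓝 η) := by
    have hlow : Tendsto (fun k : ℕ ↦ η - 1 / ((k : ℝ) + 1)) atTop (𝓝 η) := by
      have := (tendsto_one_div_add_atTop_nhds_zero_nat).const_sub η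
      simpa using this
    refine tendsto_of_tendsto_of_tendsto_of_le_of_le hlow tendsto_const_nhds (fun k ↦ ?_)
      (fun k ↦ (hη'lt k).le)
    exact (lt_of_le_of_lt (le_max_left _ _) (hη'mem k).1).le
  -- the detector inequality at each `η'_k`
  have hI : ∀ k, -(deriv riemannZeta s / riemannZeta s).re ≤
      A (η' k) + 1 / (4 * η' k) * (L (η' k) - R (η' k)) := by
    intro k
    have h := ford_zero_detector_zeta (σ := 1) (t := t) (hη'pos k) le_rfl
      (by linarith [hη'lt k]) (by linarith [hη'lt k]) ht (by simpa using hη'good k) S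
      (fun ρ hρ ↦ ⟨(hS ρ hρ).1, by simpa using hL₀S _ (hη'L₀ k) ρ hρ⟩)
    have e0 : ((1 : ℝ) - 1) / ‖((1 : ℝ) : ℂ) + t * I - 1‖ ^ 2 = 0 := by simp
    rw [e0, zero_add] at h
    exact h
  -- `s` is neither the pole nor a zero
  have hsre : s.re = 1 := by simp [hs]
  have hs1 : s ≠ 1 := fun h ↦ ht (by simpa [hs] using congrArg Complex.im h)
  have hζs : riemannZeta s ≠ 0 := riemannZeta_ne_zero_of_one_le_re (by rw [hsre])
  ------------------------------------------------------------------
  -- (1) the finite sum is continuous in `η'`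
  ------------------------------------------------------------------
  have hcot_cont : ∀ z : ℂ, z ≠ 0 → |z.re| < 2 * η →
      ContinuousAt (fun η' : ℝ ↦ fordCot η' z) η := by
    intro z hz hzre
    have hν : ContinuousAt (fun η' : ℝ ↦ (((π / (2 * η') : ℝ)) : ℂ)) η :=
      Complex.continuous_ofReal.continuousAt.comp
        (continuousAt_const.div (continuousAt_const.mul continuousAt_id)
          (by show (2 : ℝ) * η ≠ 0; positivity))
    have hsin : Complex.sin (((π / (2 * η) : ℝ) : ℂ) * z) ≠ 0 := sin_ne_zero_of_abs_re_lt hη hz hzre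
    have hcot : ContinuousAt Complex.cot (((π / (2 * η) : ℝ) : ℂ) * z) := by
      have e : Complex.cot = fun w ↦ Complex.cos w / Complex.sin w := funext Complex.cot_eq_cos_div_sin
      rw [e]
      exact Complex.continuous_cos.continuousAt.div Complex.continuous_sin.continuousAt hsin
    have hinner : ContinuousAt (fun η' : ℝ ↦ (((π / (2 * η') : ℝ)) : ℂ) * z) η :=
      hν.mul continuousAt_const
    have h2 : ContinuousAt (fun η' : ℝ ↦ Complex.cot ((((π / (2 * η') : ℝ)) : ℂ) * z)) η :=
      ContinuousAt.comp (f := fun η' : ℝ ↦ (((π / (2 * η') : ℝ)) : ℂ) * z) (x := η) hcot hinner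
    simp only [fordCot]
    exact hν.mul h2
  have hAt : Tendsto (fun k ↦ A (η' k)) atTop (𝓝 (A η)) := by
    simp only [hA]
    refine tendsto_finsetSum _ fun ρ hρ ↦ ?_
    refine Tendsto.const_mul _ ?_
    have hz : ρ - s ≠ 0 := fun h ↦ by
      have e : ρ = s := sub_eq_zero.1 h
      exact hζs (e ▸ (hS ρ hρ).1)
    have hρre : ρ.re < 1 := by
      by_contra hc
      push Not at hc
      exact riemannZeta_ne_zero_of_one_le_re hc (hS ρ hρ).1
    have hzre : |(ρ - s).re| < 2 * η := by
      rw [sub_re, hsre, abs_lt]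
      constructor <;> linarith [(hS ρ hρ).2]
    have hc := ((Complex.continuous_re.continuousAt).comp (hcot_cont (ρ - s) hz hzre)).tendsto
    exact hc.comp hη'tend
  ------------------------------------------------------------------
  -- the point maps `η' ↦ (x(η'), t + 2η'u/π)` and continuity of `log|ζ|` along them
  ------------------------------------------------------------------
  have hlog_cont : ∀ (x : ℝ → ℝ), Continuous x → ∀ u : ℝ,
      riemannZeta (((x η : ℝ) : ℂ) + ((t + u * (2 * η / π) : ℝ) : ℂ) * I) ≠ 0 →
      ((x η : ℝ) : ℂ) + ((t + u * (2 * η / π) : ℝ) : ℂ) * I ≠ 1 →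
      Tendsto (fun k ↦ Real.log ‖riemannZeta (((x (η' k) : ℝ) : ℂ) +
        ((t + u * (2 * η' k / π) : ℝ) : ℂ) * I)‖ / Real.cosh u ^ 2) atTop
        (𝓝 (Real.log ‖riemannZeta (((x η : ℝ) : ℂ) + ((t + u * (2 * η / π) : ℝ) : ℂ) * I)‖ /
          Real.cosh u ^ 2)) := by
    intro x hx u hζ0 hne1
    set P : ℝ → ℂ := fun η' ↦ ((x η' : ℝ) : ℂ) + ((t + u * (2 * η' / π) : ℝ) : ℂ) * I with hP
    have hPc : Continuous P := by rw [hP]; fun_prop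
    have hζc : ContinuousAt riemannZeta (P η) := (differentiableAt_riemannZeta hne1).continuousAt
    have h1 : Tendsto (fun η' ↦ Real.log ‖riemannZeta (P η')‖ / Real.cosh u ^ 2) (𝓝 η)
        (𝓝 (Real.log ‖riemannZeta (P η)‖ / Real.cosh u ^ 2)) := by
      refine Tendsto.div_const ?_ _
      have h2 : Tendsto (fun η' ↦ ‖riemannZeta (P η')‖) (𝓝 η) (𝓝 ‖riemannZeta (P η)‖) :=
        (continuous_norm.tendsto _).comp (hζc.tendsto.comp (hPc.tendsto η))
      exact (Real.continuousAt_log (norm_ne_zero_iff.2 hζ0)).tendsto.comp h2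
    exact h1.comp hη'tend
  ------------------------------------------------------------------
  -- (2) the right integral: dominated convergence
  ------------------------------------------------------------------
  have hRt : Tendsto (fun k ↦ R (η' k)) atTop (𝓝 (R η)) := by
    simp only [hR, hgR]
    set M : ℝ := Real.log (3 / η) with hM
    refine tendsto_integral_of_dominated_convergence (fun u ↦ M * (1 / Real.cosh u ^ 2))
      (fun k ↦ ?_) ((Literature.Analysis.SpecialFunctions.integrable_inv_cosh_sq).const_mul M)
      (fun k ↦ ae_of_all _ fun u ↦ ?_) (ae_of_all _ fun u ↦ ?_)
    · exact (ZetaLogNormVertical.integrable_log_norm_riemannZeta_ford (σ := 1 + η' k)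
        ⟨by linarith [hη'pos k], by linarith [hη'lt k]⟩ t (a := 2 * η' k / π)
        (by have := hη'pos k; positivity)).aestronglyMeasurable
    · rw [Real.norm_eq_abs, abs_div, abs_of_pos (by positivity : 0 < Real.cosh u ^ 2)]
      rw [mul_one_div]
      refine div_le_div_of_nonneg_right ?_ (by positivity)
      have := abs_log_norm_zeta_le_right hη hη2 (x := 1 + η' k) (by linarith [hη'half k])
        (by linarith [hη'lt k]) (t + u * (2 * η' k / π))
      simpa using this
    · exact hlog_cont (fun η' ↦ 1 + η') (by fun_prop) u
        (riemannZeta_ne_zero_of_one_le_re (by simp; linarith))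
        (by intro h; have := congrArg Complex.re h; simp at this; linarith)
  ------------------------------------------------------------------
  -- (3) the left integral: Fatou
  ------------------------------------------------------------------
  set Aδ : ℝ := Real.log (1 / (η / 2) + 4) + Real.log 6 + Real.log 3 with hAδ
  have hAδ0 : 0 ≤ Aδ := by
    have h1 : 0 ≤ Real.log (1 / (η / 2) + 4) := Real.log_nonneg (by
      have : 0 < 1 / (η / 2) := by positivity
      linarith)
    have h2 : 0 ≤ Real.log 6 := Real.log_nonneg (by norm_num)
    have h3 : 0 ≤ Real.log 3 := Real.log_nonneg (by norm_num)
    positivity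
  set A₀ : ℝ := Aδ + Real.log (2 + |t|) with hA₀
  have hA₀0 : 0 ≤ A₀ := add_nonneg hAδ0 (Real.log_nonneg (by linarith [abs_nonneg t]))
  set G : ℝ → ℝ := fun u ↦ (A₀ + |u|) / Real.cosh u ^ 2 with hG
  have hGint : Integrable G :=
    FordL34.integrable_div_cosh_sq_of_le (f := fun u ↦ A₀ + |u|) (by fun_prop) 1 (C := A₀ + 1)
      fun u ↦ by
        rw [abs_of_nonneg (by positivity), pow_one]
        nlinarith [abs_nonneg u]
  have hgLint : ∀ η'' : ℝ, 0 < η'' → η'' ≤ 1 / 2 → Integrable (gL η'') := fun η'' h1 h2 ↦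
    ZetaLogNormVertical.integrable_log_norm_riemannZeta_ford (σ := 1 - η'') ⟨by linarith, by linarith⟩ t
      (a := 2 * η'' / π) (by positivity)
  have hLev : ∀ ε : ℝ, 0 < ε → ∀ᶠ k in atTop, L (η' k) ≤ L η + ε := by
    intro ε hε
    simp only [hL]
    refine eventually_integral_le_of_tendsto (g := fun k ↦ gL (η' k)) (G := G) (h := gL η) hGint
      (fun k ↦ hgLint _ (hη'pos k) (by linarith [hη'lt k])) (hgLint η hη hη2)
      (fun k ↦ ae_of_all _ fun u ↦ ?_) ?_ hε
    · -- `g_k ≤ G`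
      simp only [hgL, hG]
      refine div_le_div_of_nonneg_right ?_ (by positivity)
      have hx : 1 / 2 ≤ 1 - η' k := by linarith [hη'lt k]
      have hx1 : 1 - η' k ≤ 1 - η / 2 := by linarith [hη'half k]
      have h := log_norm_zeta_le_crude (δ := η / 2) (by positivity) (by linarith) hx hx1
        (t + u * (2 * η' k / π))
      have hy : Real.log (2 + |t + u * (2 * η' k / π)|) ≤ Real.log (2 + |t|) + |u| := by
        have hc : 0 ≤ 2 * η' k / π := by have := hη'pos k; positivity
        have hc1 : 2 * η' k / π ≤ 1 := by
          rw [div_le_one Real.pi_pos]; linarith [hη'lt k, Real.pi_gt_three]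
        have h1 : |t + u * (2 * η' k / π)| ≤ |t| + |u| := by
          refine (abs_add_le _ _).trans ?_
          rw [abs_mul, abs_of_nonneg hc]
          nlinarith [abs_nonneg u]
        have h2 : 2 + |t + u * (2 * η' k / π)| ≤ (2 + |t|) * Real.exp |u| := by
          have := Real.add_one_le_exp |u|
          nlinarith [abs_nonneg t, abs_nonneg u]
        calc Real.log (2 + |t + u * (2 * η' k / π)|) ≤ Real.log ((2 + |t|) * Real.exp |u|) :=
              Real.log_le_log (by positivity) h2
          _ = Real.log (2 + |t|) + |u| := by
              rw [Real.log_mul (by positivity) (Real.exp_pos _).ne', Real.log_exp]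
      have e : (((1 - η' k : ℝ)) : ℂ) = ((1 - η' k : ℝ) : ℂ) := rfl
      simp only [hA₀, hAδ]
      push_cast at h ⊢
      linarith
    · -- a.e. convergence: off the countable set where the limit point is a zero
      set P : ℝ → ℂ := fun u ↦ (((1 - η : ℝ)) : ℂ) + ((t + u * (2 * η / π) : ℝ) : ℂ) * I with hP
      have hinj : Function.Injective P := by
        intro u v huv
        have := congrArg Complex.im huv
        simp [hP] at this
        rcases this with h | h
        · exact h
        · exfalso; exact hη.ne' h
      have hE : (P ⁻¹' riemannZetaZeros).Countable := countable_riemannZetaZeros.preimage hinj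
      have hae : ∀ᵐ u : ℝ, u ∉ P ⁻¹' riemannZetaZeros :=
        measure_eq_zero_iff_ae_notMem.1 (hE.measure_zero volume)
      filter_upwards [hae] with u hu
      have hζ0 : riemannZeta (P u) ≠ 0 := fun h ↦ hu h
      have hne1 : P u ≠ 1 := by
        intro h; have := congrArg Complex.re h; simp [hP] at this; linarith
      exact hlog_cont (fun η' ↦ 1 - η') (by fun_prop) u hζ0 hne1
  ------------------------------------------------------------------
  -- (4) conclusion
  ------------------------------------------------------------------
  refine le_of_forall_pos_le_add fun ε' hε' ↦ ?_
  set ε : ℝ := 4 * η * ε' with hε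
  have hε0 : 0 < ε := by positivity
  have hinv : Tendsto (fun k ↦ 1 / (4 * η' k)) atTop (𝓝 (1 / (4 * η))) :=
    ((continuousAt_const.div (continuousAt_const.mul continuousAt_id)
      (by show (4 : ℝ) * η ≠ 0; positivity)).tendsto).comp hη'tend
  have hΦ : Tendsto (fun k ↦ A (η' k) + 1 / (4 * η' k) * (L η + ε - R (η' k))) atTop
      (𝓝 (A η + 1 / (4 * η) * (L η + ε - R η))) :=
    hAt.add (hinv.mul (tendsto_const_nhds.sub hRt))
  have hev : ∀ᶠ k in atTop, -(deriv riemannZeta s / riemannZeta s).re ≤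
      A (η' k) + 1 / (4 * η' k) * (L η + ε - R (η' k)) := by
    filter_upwards [hLev ε hε0] with k hk
    refine (hI k).trans ?_
    have hpos : 0 ≤ 1 / (4 * η' k) := by have := hη'pos k; positivity
    nlinarith
  have hfin := ge_of_tendsto hΦ hev
  have e : A η + 1 / (4 * η) * (L η + ε - R η) = A η + 1 / (4 * η) * (L η - R η) + ε' := by
    rw [hε]; field_simp; ring
  linarith [hfin, e]

end FordZetaDetector

end Literature.NumberTheory.LFunctions
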